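import Summits.ABC.IUTFork.Joshi.ATS4ExistenceLemmas
import Literature.NumberTheory.Multiplicative.ChebyshevThetaExplicit
import Mathlib.Analysis.Complex.ExponentialBounds
import HarnessLib

/-!
# Joshi, *Arithmetic Teichmüller Spaces IV* (arXiv:2403.10430v2) §5.8: Lemma 5.8.7 AS PRINTED holds unconditionally
# (proof-only companion of `Joshi/ATS4ExistenceLemmas.lean`)

Proof-only companion file of the abc-iut cell, branch E «type Joshi's construction, test vs S» (rung LADDER-ABC:A2.E; seat
abc-iut-E-t54 = the «[J-IV] DERIVABLE seat», plan/E/ASSIGNMENTS (E-plan-2 07:46:39Z); row R1 of the slot owner E-t29's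
list 08:10:45Z). **No side is taken** on [IUTchIII] Cor. 3.12 / [IUTchIV] Thm. 1.10, on Joshi's claims (unrefereed arXiv
preprint) or on Mochizuki's report on them; typed ≠ proved ≠ endorsed. Locators «p.N l.M» = line M of page file `pNNNN.txt`
of the cell's render `HOME/lit/renders/Joshi-arxiv-2403.10430/` (v2). Nothing of the disputed chain occurs here: §5.8 is the
classical prime-choice step of [IUTchIV] Cor. 2.2 (ii) / [GenEll] Lem. 4.1.

WHAT E-t29's object file records (p430600, DEFS-FREEZE — imported BY NAME, never edited): `TateDatum.Lem587` — Lemma 5.8.7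
under the RUNNING hypothesis «Q^{1/2} ≥ ξ_prm ≥ 5» (p.54 l.27–28), DISCHARGED there through the tree's [IUTchIV] (P1)–(P3)
(`Cor22.PrimeChoiceData.exists_prime_P1_P2_P3`), whose `ξ_prm` is the INEFFECTIVE constant of [IUTchIV] Prop. 2.1 (ii)
(`Literature.IUT.LogVolume.exists_isXiPrm`, from the prime number theorem); and `TateDatum.Lem587AsPrinted` — **[J-IV] Lemma
5.8.7 AS PRINTED** (p.56 l.33–40): «Assume that Q^{1/2} ≥ 5, the following assertions hold: (1) There exists a rational
prime ℓ satisfying Q^{1/2} ≤ ℓ ≤ 10·δ·Q^{1/2}·log(2·δ·Q); (2) ℓ ∤ a_v for any a_v ≠ 0 and v ∈ V^non_L; (3) if ℓ = p_v for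
some v ∈ V^non_L, then a_v < Q^{1/2}» — typed only, with the located discrepancy (D4) «printed hypothesis only Q^{1/2} ≥ 5».

WHAT THIS FILE PROVES: `TateDatum.lem587AsPrinted_holds : 𝔗.Lem587AsPrinted` for EVERY `TateDatum 𝔗` — i.e. the printed
hypothesis «Q^{1/2} ≥ 5» alone suffices; (D4) is thereby CLOSED IN KERNEL as «as-printed form TRUE» (the printed proof's
route through `ξ_prm` is not needed). Route: the EFFECTIVE Chebyshev bound `x/4 ≤ θ(x)` (`x ≥ 3`) and the effective prime
avoidance lemma of `Literature.NumberTheory.Multiplicative.ChebyshevThetaExplicit` (Rosser–Schoenfeld-type, proved in the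
tree from Mathlib's `Chebyshev.theta_ge'` + primorial checkpoints) replace `ξ_prm`: with `s = Q^{1/2} ≥ 5`, `δ ≥ 2`,
`L = log(2δQ) ≥ 4`, the excluded set `A` of Lemma 5.8.2 has `θ_A ≤ (log 4)·s + δ·s + 2δ·s·L` ((S1) by Mathlib's
`θ(x) ≤ (log 4)·x`; (S2), (S3) = the counting estimates of [IUTchIV] p.44, re-proved here over `TateDatum` WITHOUT `ξ_prm`),
and `(log 4)·s + δ·s + 2δ·s·L < (10·δ·s·L)/4`, so some prime `ℓ ≤ 10·δ·s·L` avoids `A`; (1)–(3) follow as in [IUTchIV] p.45.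

[claim: Joshi2024ATS4, status: disputed] (locators only); the estimates are [folklore] / [IUTchIV] Cor. 2.2 (ii) proof p.44
bookkeeping (tree twin: `Literature.IUT.LogVolume.Cor22.PrimeChoiceData.sum_log_pv_le` / `sum_log_hv_le`, which need `ξ_prm`
only through their carrier). Standard axioms only; no new definition, no new `Prop` fact.
-/

noncomputable section

open Real Finset
open scoped Chebyshev
open Literature.IUT.LogVolume Literature.NumberTheory.Multiplicative

namespace Summit.ABC.IUTFork.Joshi.ATS4

namespace TateDatum

variable (𝔗 : TateDatum)

/-! ## 1. Elementary consequences of the printed hypothesis «Q^{1/2} ≥ 5» -/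

/-- `Q^{1/2} ≥ 5 ⟹ Q > 0`, `Q ≥ 25`, `(√Q)² = Q`. [folklore] -/
private theorem Q_facts (h5 : 5 ≤ Real.sqrt 𝔗.Q) : 0 < 𝔗.Q ∧ 25 ≤ 𝔗.Q ∧ Real.sqrt 𝔗.Q ^ 2 = 𝔗.Q := by
  have hQ0 : 0 < 𝔗.Q := by
    by_contra hle
    rw [not_lt] at hle
    rw [Real.sqrt_eq_zero'.mpr hle] at h5
    linarith
  have hsq : Real.sqrt 𝔗.Q ^ 2 = 𝔗.Q := Real.sq_sqrt hQ0.le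
  exact ⟨hQ0, by nlinarith, hsq⟩

/-- `Q^{1/2} ≥ 5 ⟹ log(2δQ) ≥ 4` (`2δQ ≥ 100 > e⁴ ≈ 54.6`). [folklore] -/
private theorem four_le_log (h5 : 5 ≤ Real.sqrt 𝔗.Q) : 4 ≤ Real.log (2 * 𝔗.δ * 𝔗.Q) := by
  obtain ⟨_, hQ, _⟩ := 𝔗.Q_facts h5
  have hδ := 𝔗.two_le_δ
  have h100 : (100 : ℝ) ≤ 2 * 𝔗.δ * 𝔗.Q := by nlinarith
  rw [Real.le_log_iff_exp_le (by linarith)]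
  have he : Real.exp 4 = Real.exp 1 ^ 4 := by rw [Real.exp_one_pow]; norm_num
  have h1 := Real.exp_one_lt_d9
  have h0 := Real.exp_pos 1
  have : Real.exp 1 ^ 4 < 2.7182818286 ^ 4 := by gcongr
  nlinarith

/-- Each term of `Σ_v a_v·f_v·log(p_v)` is `≥ 0`. [folklore] -/
private theorem term_nonneg (v : 𝔗.ι) (_hv : v ∈ 𝔗.V) : 0 ≤ (𝔗.a v : ℝ) * (𝔗.f v : ℝ) * Real.log (𝔗.p v) := by
  have := Real.log_natCast_nonneg (𝔗.p v); positivity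

/-! ## 2. The counting estimates (S3), (S2) of [IUTchIV] p.44 over `TateDatum`, WITHOUT `ξ_prm` -/

/-- **(S3) without `ξ_prm`** (= display (5.8.6)'s `v`-sum form, p.56 l.27–31): `Σ_{a_v ≥ Q^{1/2}} log(p_v) ≤ δ·Q^{1/2}`
(`Q^{1/2}·Σ ≤ Σ_{a_v ≥ √Q} a_v f_v log p_v ≤ [L:ℚ]·Q ≤ δ·Q`). [folklore] -/
theorem sum_log_p_bigPlaces_le' (h5 : 5 ≤ Real.sqrt 𝔗.Q) :
    ∑ v ∈ 𝔗.bigPlaces, Real.log (𝔗.p v : ℝ) ≤ 𝔗.δ * Real.sqrt 𝔗.Q := by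
  obtain ⟨hQ0, _, hsq⟩ := 𝔗.Q_facts h5
  have hs0 : 0 < Real.sqrt 𝔗.Q := by linarith
  have h1 : Real.sqrt 𝔗.Q * ∑ v ∈ 𝔗.bigPlaces, Real.log (𝔗.p v : ℝ) ≤
      ∑ v ∈ 𝔗.bigPlaces, (𝔗.a v : ℝ) * (𝔗.f v : ℝ) * Real.log (𝔗.p v) := by
    rw [Finset.mul_sum]
    refine Finset.sum_le_sum fun v hv => ?_
    rw [bigPlaces, Finset.mem_filter] at hv
    have hf : (1 : ℝ) ≤ 𝔗.f v := by exact_mod_cast 𝔗.one_le_f v hv.1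
    have hl : 0 ≤ Real.log (𝔗.p v : ℝ) := Real.log_natCast_nonneg _
    have ea : Real.sqrt 𝔗.Q * Real.log (𝔗.p v) ≤ (𝔗.a v : ℝ) * Real.log (𝔗.p v) :=
      mul_le_mul_of_nonneg_right hv.2 hl
    have eb : (𝔗.a v : ℝ) * Real.log (𝔗.p v) * 1 ≤ (𝔗.a v : ℝ) * Real.log (𝔗.p v) * (𝔗.f v : ℝ) :=
      mul_le_mul_of_nonneg_left hf (mul_nonneg (by positivity) hl)
    have e : (𝔗.a v : ℝ) * (𝔗.f v : ℝ) * Real.log (𝔗.p v) = (𝔗.a v : ℝ) * Real.log (𝔗.p v) * (𝔗.f v : ℝ) := by ring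
    rw [e]; linarith
  have h2 : ∑ v ∈ 𝔗.bigPlaces, (𝔗.a v : ℝ) * (𝔗.f v : ℝ) * Real.log (𝔗.p v) ≤ (𝔗.degL : ℝ) * 𝔗.Q := by
    rw [𝔗.Q_def]
    exact Finset.sum_le_sum_of_subset_of_nonneg (Finset.filter_subset _ _) fun v hv _ => 𝔗.term_nonneg v hv
  have h3 : (𝔗.degL : ℝ) * 𝔗.Q ≤ 𝔗.δ * 𝔗.Q := mul_le_mul_of_nonneg_right 𝔗.degL_le_δ hQ0.le
  have h4 : 𝔗.δ * 𝔗.Q = 𝔗.δ * Real.sqrt 𝔗.Q * Real.sqrt 𝔗.Q := by rw [mul_assoc, ← sq, hsq]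
  have : Real.sqrt 𝔗.Q * ∑ v ∈ 𝔗.bigPlaces, Real.log (𝔗.p v : ℝ) ≤ (𝔗.δ * Real.sqrt 𝔗.Q) * Real.sqrt 𝔗.Q := by
    linarith
  rw [mul_comm] at this
  exact le_of_mul_le_mul_right this hs0

/-- **(S2) without `ξ_prm`** ([IUTchIV] p.44 «h_v^{1/2}·log(h_v) ≤ … », in Joshi's notation): `Σ_{a_v ≥ Q^{1/2}} log(a_v) ≤
2δ·Q^{1/2}·log(2δ·Q)` — via `2·log(p_v) ≥ log 4 ≥ 1`, `a_v ≤ 2δQ`. [folklore] -/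
theorem sum_log_a_bigPlaces_le' (h5 : 5 ≤ Real.sqrt 𝔗.Q) :
    ∑ v ∈ 𝔗.bigPlaces, Real.log (𝔗.a v : ℝ) ≤ 2 * 𝔗.δ * Real.sqrt 𝔗.Q * Real.log (2 * 𝔗.δ * 𝔗.Q) := by
  obtain ⟨hQ0, _, hsq⟩ := 𝔗.Q_facts h5
  have hs0 : 0 < Real.sqrt 𝔗.Q := by linarith
  have hlog1 : 1 ≤ Real.log (2 * 𝔗.δ * 𝔗.Q) := le_trans (by norm_num) (𝔗.four_le_log h5)
  have hδ := 𝔗.two_le_δ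
  have hterm : ∀ v ∈ 𝔗.bigPlaces, Real.sqrt 𝔗.Q * Real.log (𝔗.a v) ≤
      2 * ((𝔗.a v : ℝ) * (𝔗.f v : ℝ) * Real.log (𝔗.p v)) * Real.log (2 * 𝔗.δ * 𝔗.Q) := by
    intro v hv
    rw [bigPlaces, Finset.mem_filter] at hv
    obtain ⟨hvV, hge⟩ := hv
    have ha1 : (1 : ℝ) ≤ 𝔗.a v := by linarith
    have hloga : 0 ≤ Real.log (𝔗.a v : ℝ) := Real.log_nonneg ha1
    have hf : (1 : ℝ) ≤ 𝔗.f v := by exact_mod_cast 𝔗.one_le_f v hvV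
    have hp2 : (2 : ℝ) ≤ 𝔗.p v := by exact_mod_cast (𝔗.p_prime v hvV).two_le
    -- `2·log p_v ≥ log 4 ≥ 1`
    have hlogp : 1 ≤ 2 * Real.log (𝔗.p v : ℝ) := by
      have h22 : Real.log 4 ≤ Real.log ((𝔗.p v : ℝ) ^ 2) := Real.log_le_log (by norm_num) (by nlinarith)
      rw [Real.log_pow] at h22
      have h4 : 1 ≤ Real.log (4 : ℝ) := by
        have he : Real.exp 1 ≤ 4 := by have := Real.exp_one_lt_d9; linarith
        calc (1 : ℝ) = Real.log (Real.exp 1) := (Real.log_exp 1).symm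
          _ ≤ Real.log 4 := Real.log_le_log (Real.exp_pos 1) he
      push_cast at h22; linarith
    -- `a_v ≤ 2δQ`, hence `log a_v ≤ log(2δQ)`
    have hterm_le : (𝔗.a v : ℝ) * (𝔗.f v : ℝ) * Real.log (𝔗.p v) ≤ (𝔗.degL : ℝ) * 𝔗.Q := by
      rw [𝔗.Q_def]
      exact Finset.single_le_sum (fun w hw => 𝔗.term_nonneg w hw) hvV
    have hale : (𝔗.a v : ℝ) ≤ 2 * 𝔗.δ * 𝔗.Q := by
      have e1 : (𝔗.a v : ℝ) * 1 ≤ (𝔗.a v : ℝ) * ((𝔗.f v : ℝ) * (2 * Real.log (𝔗.p v))) := by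
        apply mul_le_mul_of_nonneg_left _ (by positivity); nlinarith
      have e3 := mul_le_mul_of_nonneg_right 𝔗.degL_le_δ hQ0.le
      nlinarith
    have hloga_le : Real.log (𝔗.a v : ℝ) ≤ Real.log (2 * 𝔗.δ * 𝔗.Q) := Real.log_le_log (by linarith) hale
    have a1 : Real.sqrt 𝔗.Q * Real.log (𝔗.a v) ≤ (𝔗.a v : ℝ) * Real.log (𝔗.a v) :=
      mul_le_mul_of_nonneg_right hge hloga
    have a2 : (𝔗.a v : ℝ) * Real.log (𝔗.a v) ≤ (𝔗.a v : ℝ) * Real.log (2 * 𝔗.δ * 𝔗.Q) :=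
      mul_le_mul_of_nonneg_left hloga_le (by positivity)
    have a3 : (𝔗.a v : ℝ) * Real.log (2 * 𝔗.δ * 𝔗.Q) ≤
        (𝔗.a v : ℝ) * ((𝔗.f v : ℝ) * (2 * Real.log (𝔗.p v))) * Real.log (2 * 𝔗.δ * 𝔗.Q) := by
      have : (𝔗.a v : ℝ) ≤ (𝔗.a v : ℝ) * ((𝔗.f v : ℝ) * (2 * Real.log (𝔗.p v))) := by
        have : (1 : ℝ) ≤ (𝔗.f v : ℝ) * (2 * Real.log (𝔗.p v)) := by nlinarith
        nlinarith
      exact mul_le_mul_of_nonneg_right this (by linarith)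
    nlinarith
  have hsum : Real.sqrt 𝔗.Q * ∑ v ∈ 𝔗.bigPlaces, Real.log (𝔗.a v : ℝ) ≤
      2 * (∑ v ∈ 𝔗.bigPlaces, (𝔗.a v : ℝ) * (𝔗.f v : ℝ) * Real.log (𝔗.p v)) * Real.log (2 * 𝔗.δ * 𝔗.Q) := by
    rw [Finset.mul_sum, Finset.mul_sum, Finset.sum_mul]
    exact Finset.sum_le_sum hterm
  have hsub : ∑ v ∈ 𝔗.bigPlaces, (𝔗.a v : ℝ) * (𝔗.f v : ℝ) * Real.log (𝔗.p v) ≤ (𝔗.degL : ℝ) * 𝔗.Q := by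
    rw [𝔗.Q_def]
    exact Finset.sum_le_sum_of_subset_of_nonneg (Finset.filter_subset _ _) fun v hv _ => 𝔗.term_nonneg v hv
  have hd : (𝔗.degL : ℝ) * 𝔗.Q ≤ 𝔗.δ * 𝔗.Q := mul_le_mul_of_nonneg_right 𝔗.degL_le_δ hQ0.le
  have hfinal : Real.sqrt 𝔗.Q * ∑ v ∈ 𝔗.bigPlaces, Real.log (𝔗.a v : ℝ) ≤
      (2 * 𝔗.δ * Real.sqrt 𝔗.Q * Real.log (2 * 𝔗.δ * 𝔗.Q)) * Real.sqrt 𝔗.Q := by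
    have e1 : 2 * ((𝔗.degL : ℝ) * 𝔗.Q) * Real.log (2 * 𝔗.δ * 𝔗.Q) ≤ 2 * (𝔗.δ * 𝔗.Q) * Real.log (2 * 𝔗.δ * 𝔗.Q) := by
      nlinarith
    have e : 2 * (𝔗.δ * 𝔗.Q) * Real.log (2 * 𝔗.δ * 𝔗.Q) =
        (2 * 𝔗.δ * Real.sqrt 𝔗.Q * Real.log (2 * 𝔗.δ * 𝔗.Q)) * Real.sqrt 𝔗.Q := by
      linear_combination (2 * 𝔗.δ * Real.log (2 * 𝔗.δ * 𝔗.Q)) * hsq.symm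
    nlinarith [Finset.sum_nonneg (fun v (hv : v ∈ 𝔗.bigPlaces) => 𝔗.term_nonneg v (Finset.mem_filter.mp hv).1)]
  rw [mul_comm] at hfinal
  exact le_of_mul_le_mul_right hfinal hs0

/-! ## 3. `θ_A` for the set `A` of Lemma 5.8.2, WITHOUT `ξ_prm` -/

/-- `Σ_{p ∈ ⋃_{x∈s} t(x)} g(p) ≤ Σ_{x∈s} Σ_{p∈t(x)} g(p)` for `g ≥ 0`. [folklore] -/
private theorem sum_biUnion_le {κ : Type*} (s : Finset κ) (t : κ → Finset ℕ) (g : ℕ → ℝ) (hg : ∀ n, 0 ≤ g n) :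
    ∑ q ∈ s.biUnion t, g q ≤ ∑ x ∈ s, ∑ q ∈ t x, g q := by
  classical
  induction s using Finset.induction_on with
  | empty => simp
  | insert a s ha ih =>
    rw [Finset.biUnion_insert, Finset.sum_insert ha]
    have hu : ∑ q ∈ t a ∪ s.biUnion t, g q ≤ ∑ q ∈ t a, g q + ∑ q ∈ s.biUnion t, g q := by
      rw [← Finset.sum_union_inter]
      have : 0 ≤ ∑ q ∈ t a ∩ s.biUnion t, g q := Finset.sum_nonneg fun q _ => hg q
      linarith
    linarith

/-- `Σ_{A ∪ B} g ≤ Σ_A g + Σ_B g` for `g ≥ 0`. [folklore] -/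
private theorem sum_union_le (A B : Finset ℕ) (g : ℕ → ℝ) (hg : ∀ n, 0 ≤ g n) :
    ∑ q ∈ A ∪ B, g q ≤ ∑ q ∈ A, g q + ∑ q ∈ B, g q := by
  rw [← Finset.sum_union_inter]
  have : 0 ≤ ∑ q ∈ A ∩ B, g q := Finset.sum_nonneg fun q _ => hg q
  linarith

/-- For `n ≥ 1`: `Σ_{p | n} log p ≤ log n`. [folklore] -/
private theorem sum_log_primeFactors_le {n : ℕ} (hn : n ≠ 0) : ∑ q ∈ n.primeFactors, Real.log q ≤ Real.log n := by
  have hprod : (∏ q ∈ n.primeFactors, (q : ℝ)) = ((∏ q ∈ n.primeFactors, q : ℕ) : ℝ) := by push_cast; rfl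
  rw [← Real.log_prod (s := n.primeFactors) (f := fun q : ℕ => (q : ℝ))
    (fun q hq => by exact_mod_cast (Nat.prime_of_mem_primeFactors hq).ne_zero), hprod]
  apply Real.log_le_log
  · exact_mod_cast Finset.prod_pos fun q hq => (Nat.prime_of_mem_primeFactors hq).pos
  · exact_mod_cast Nat.le_of_dvd (Nat.pos_of_ne_zero hn) (Nat.prod_primeFactors_dvd n)

/-- **`θ_A` bound from «Q^{1/2} ≥ 5» alone**: `θ_A ≤ (log 4)·Q^{1/2} + δ·Q^{1/2} + 2δ·Q^{1/2}·log(2δ·Q)` — (S1) by Mathlib's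
Chebyshev bound `θ(x) ≤ (log 4)·x` at `x = Q^{1/2}` (in place of the printed «≤ (4/3)·Q^{1/2}» via `ξ_prm`), (S2′) through
`Σ_{p | a_v} log p ≤ log(a_v)` and `sum_log_a_bigPlaces_le'` (a prime dividing some `0 < a_v < Q^{1/2}` lies in (S1)),
(S3) by `sum_log_p_bigPlaces_le'`. [folklore] -/
theorem thetaSet_lem582Set_le' (h5 : 5 ≤ Real.sqrt 𝔗.Q) :
    thetaSet 𝔗.lem582Set ≤
      Real.log 4 * Real.sqrt 𝔗.Q + 𝔗.δ * Real.sqrt 𝔗.Q + 2 * 𝔗.δ * Real.sqrt 𝔗.Q * Real.log (2 * 𝔗.δ * 𝔗.Q) := by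
  classical
  have hs0 : 0 < Real.sqrt 𝔗.Q := by linarith
  have hg : ∀ n : ℕ, 0 ≤ Real.log (n : ℝ) := fun n => Real.log_natCast_nonneg n
  set S1 : Finset ℕ := Nat.primesLE ⌊Real.sqrt 𝔗.Q⌋₊ with hS1
  set S2' : Finset ℕ := 𝔗.bigPlaces.biUnion (fun v => (𝔗.a v).primeFactors) with hS2'
  set S3 : Finset ℕ := 𝔗.bigPlaces.image 𝔗.p with hS3
  have hsub : 𝔗.lem582Set ⊆ S1 ∪ S2' ∪ S3 := by
    intro q hq
    simp only [lem582Set, Finset.mem_union] at hq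
    rcases hq with (h1 | h2) | h3
    · exact Finset.mem_union_left _ (Finset.mem_union_left _ h1)
    · rw [Finset.mem_biUnion] at h2
      obtain ⟨v, hv, hqv⟩ := h2
      rw [Finset.mem_filter] at hv
      rcases le_or_gt (Real.sqrt 𝔗.Q) (𝔗.a v : ℝ) with hge | hlt
      · refine Finset.mem_union_left _ (Finset.mem_union_right _ ?_)
        rw [hS2', Finset.mem_biUnion]
        exact ⟨v, by rw [bigPlaces, Finset.mem_filter]; exact ⟨hv.1, hge⟩, hqv⟩
      · refine Finset.mem_union_left _ (Finset.mem_union_left _ ?_)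
        have hqp : q.Prime := Nat.prime_of_mem_primeFactors hqv
        have hqle : (q : ℝ) ≤ 𝔗.a v := by
          exact_mod_cast Nat.le_of_dvd (Nat.pos_of_ne_zero hv.2) (Nat.dvd_of_mem_primeFactors hqv)
        rw [hS1, Nat.mem_primesLE]
        exact ⟨Nat.le_floor (by linarith), hqp⟩
    · exact Finset.mem_union_right _ h3
  -- (S1): Mathlib's Chebyshev upper bound
  have h1 : ∑ q ∈ S1, Real.log (q : ℝ) ≤ Real.log 4 * Real.sqrt 𝔗.Q := by
    have hθ1 : θ (Real.sqrt 𝔗.Q) = ∑ q ∈ S1, Real.log (q : ℝ) := by rw [Chebyshev.theta_eq_sum_primesLE]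
    rw [← hθ1]
    exact Chebyshev.theta_le_log4_mul_x hs0.le
  -- (S2′)
  have h2 : ∑ q ∈ S2', Real.log (q : ℝ) ≤ 2 * 𝔗.δ * Real.sqrt 𝔗.Q * Real.log (2 * 𝔗.δ * 𝔗.Q) := by
    refine le_trans (sum_biUnion_le 𝔗.bigPlaces _ _ hg)
      (le_trans (Finset.sum_le_sum fun v hv => ?_) (𝔗.sum_log_a_bigPlaces_le' h5))
    have hv' : Real.sqrt 𝔗.Q ≤ (𝔗.a v : ℝ) := (Finset.mem_filter.mp hv).2
    exact sum_log_primeFactors_le (by intro h0; rw [h0] at hv'; push_cast at hv'; linarith)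
  -- (S3)
  have h3 : ∑ q ∈ S3, Real.log (q : ℝ) ≤ 𝔗.δ * Real.sqrt 𝔗.Q :=
    le_trans (Finset.sum_image_le_of_nonneg fun q _ => Real.log_natCast_nonneg q) (𝔗.sum_log_p_bigPlaces_le' h5)
  have hmono : thetaSet 𝔗.lem582Set ≤ ∑ q ∈ S1 ∪ S2' ∪ S3, Real.log (q : ℝ) :=
    Finset.sum_le_sum_of_subset_of_nonneg hsub fun q _ _ => hg q
  have hu1 := sum_union_le (S1 ∪ S2') S3 _ hg
  have hu2 := sum_union_le S1 S2' _ hg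
  linarith

/-- The numerical heart: `(log 4)·s + δ·s + 2δ·s·L < (10·δ·s·L)/4` for `s > 0`, `δ ≥ 2`, `L ≥ 4` (since `log 4 < 2 ≤ δ`
and `L ≥ 4` gives `(1/2)·δ·s·L ≥ 2δ·s`). [folklore] -/
private theorem key_ineq {s δ L : ℝ} (hs : 0 < s) (hδ : 2 ≤ δ) (hL : 4 ≤ L) :
    Real.log 4 * s + δ * s + 2 * δ * s * L < 10 * δ * s * L / 4 := by
  have hl4 : Real.log 4 < 2 := by
    have : Real.log 4 = 2 * Real.log 2 := by
      rw [show (4 : ℝ) = 2 ^ 2 by norm_num, Real.log_pow]; norm_num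
    rw [this]; have := Real.log_two_lt_d9; linarith
  have h1 : 0 ≤ δ * s * (L - 4) := mul_nonneg (mul_nonneg (by linarith) hs.le) (by linarith)
  have h2 : 0 < s * (δ - Real.log 4) := mul_pos hs (by linarith)
  nlinarith [h1, h2]

/-- `θ_A < X/4` and `X ≥ 3` for `X = 10·δ·Q^{1/2}·log(2δ·Q)`, under «Q^{1/2} ≥ 5». [folklore] -/
private theorem thetaSet_lt_quarter (h5 : 5 ≤ Real.sqrt 𝔗.Q) :
    thetaSet 𝔗.lem582Set < 10 * 𝔗.δ * Real.sqrt 𝔗.Q * Real.log (2 * 𝔗.δ * 𝔗.Q) / 4 ∧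
      (3 : ℝ) ≤ 10 * 𝔗.δ * Real.sqrt 𝔗.Q * Real.log (2 * 𝔗.δ * 𝔗.Q) := by
  have hs0 : 0 < Real.sqrt 𝔗.Q := by linarith
  have hδ := 𝔗.two_le_δ
  have hL := 𝔗.four_le_log h5
  refine ⟨lt_of_le_of_lt (𝔗.thetaSet_lem582Set_le' h5) (key_ineq hs0 hδ hL), ?_⟩
  have h1 : (2 : ℝ) * 5 ≤ 𝔗.δ * Real.sqrt 𝔗.Q := mul_le_mul hδ h5 (by norm_num) (by linarith)
  have h2 : 𝔗.δ * Real.sqrt 𝔗.Q * 4 ≤ 𝔗.δ * Real.sqrt 𝔗.Q * Real.log (2 * 𝔗.δ * 𝔗.Q) :=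
    mul_le_mul_of_nonneg_left hL (by positivity)
  nlinarith

/-! ## 4. Lemma 5.8.7 AS PRINTED, unconditionally -/

/-- **Lemma 5.8.7's conclusion from «Q^{1/2} ≥ 5» alone**: there is a prime `ℓ` with (1) `Q^{1/2} ≤ ℓ ≤ 10·δ·Q^{1/2}·log(2δQ)`,
(2) `ℓ ∤ a_v` for `a_v ≠ 0`, (3) `p_v = ℓ ⟹ a_v < Q^{1/2}` — the prime `ℓ ≤ X` avoiding the set `A` of Lemma 5.8.2
supplied by the EFFECTIVE prime-avoidance lemma (`θ_A < X/4 ≤ θ(X)`), then (1)–(3) read off `ℓ ∉ A` exactly as in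
[IUTchIV] p.45 / `Cor22.PrimeChoiceData.exists_prime_P1_P2_P3`. [claim: Joshi2024ATS4, status: disputed] -/
theorem exists_lem587Concl_of_five_le_sqrt (h5 : 5 ≤ Real.sqrt 𝔗.Q) : ∃ ℓ : ℕ, 𝔗.Lem587Concl ℓ := by
  classical
  obtain ⟨hlt, h3X⟩ := 𝔗.thetaSet_lt_quarter h5
  obtain ⟨l, hlp, hlA, hlle⟩ := exists_prime_not_mem_le_of_sum_log_lt_quarter h3X hlt
  refine ⟨l, hlp, ⟨?_, hlle⟩, ?_, ?_⟩
  · -- (1), lower bound: `l ∉ primesLE ⌊√Q⌋` means `l > ⌊√Q⌋`, so `l ≥ √Q`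
    have hl1 : l ∉ Nat.primesLE ⌊Real.sqrt 𝔗.Q⌋₊ := fun h =>
      hlA (by rw [lem582Set]; exact Finset.mem_union_left _ (Finset.mem_union_left _ h))
    have : ¬ (l ≤ ⌊Real.sqrt 𝔗.Q⌋₊) := fun h => hl1 (by rw [Nat.mem_primesLE]; exact ⟨h, hlp⟩)
    have hlt' : ⌊Real.sqrt 𝔗.Q⌋₊ < l := by omega
    exact (Nat.lt_of_floor_lt hlt').le
  · -- (2): `l ∣ a_v ≠ 0` would put `l` among the prime factors of `a_v`, i.e. in `A`
    intro v hvV hne hdvd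
    exact hlA (by
      rw [lem582Set]
      refine Finset.mem_union_left _ (Finset.mem_union_right _ ?_)
      rw [Finset.mem_biUnion]
      exact ⟨v, by rw [Finset.mem_filter]; exact ⟨hvV, hne⟩, Nat.mem_primeFactors.mpr ⟨hlp, hdvd, hne⟩⟩)
  · -- (3): `a_v ≥ √Q` and `p_v = l` would put `l` in the image part of `A`
    intro v hvV hpl
    by_contra hge
    rw [not_lt] at hge
    exact hlA (by
      rw [lem582Set]
      refine Finset.mem_union_right _ ?_
      rw [Finset.mem_image]
      exact ⟨v, by rw [bigPlaces, Finset.mem_filter]; exact ⟨hvV, hge⟩, hpl⟩)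

/-- **[J-IV] Lemma 5.8.7 AS PRINTED HOLDS** (p.56 l.33–40: hypothesis «Q^{1/2} ≥ 5» ONLY) for every `TateDatum` — the located
discrepancy (D4) of `Joshi/ATS4ExistenceLemmas.lean` («the printed proof applies Lemma 5.8.1 at Q^{1/2}, i.e. uses the running
hypothesis Q^{1/2} ≥ ξ_prm») is CLOSED IN KERNEL: the as-printed statement is TRUE, by an effective Chebyshev bound instead of
the ineffective `ξ_prm`. DISCHARGED. [claim: Joshi2024ATS4, status: disputed] -/
theorem lem587AsPrinted_holds : 𝔗.Lem587AsPrinted := fun h5 => 𝔗.exists_lem587Concl_of_five_le_sqrt h5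

/-- Hence also E-t29's running-hypothesis form `Lem587 ξ_prm` holds for EVERY real `ξ_prm ≤ Q^{1/2}` with `ξ_prm ≥ 5`, whether or
not `IsXiPrm ξ_prm` (the Chebyshev property of `ξ_prm` is not needed). [claim: Joshi2024ATS4, status: disputed] -/
theorem exists_lem587Concl_of_le_sqrt {ξ : ℝ} (h5 : 5 ≤ ξ) (hξQ : ξ ≤ Real.sqrt 𝔗.Q) : ∃ ℓ : ℕ, 𝔗.Lem587Concl ℓ :=
  𝔗.exists_lem587Concl_of_five_le_sqrt (le_trans h5 hξQ)

end TateDatum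

end Summit.ABC.IUTFork.Joshi.ATS4

end
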